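import Literature.Analysis.FluidPDE.CKNMorreyDualEstimate
import Literature.Analysis.FluidPDE.CKNMorreyRepresentation
import Literature.Analysis.FluidPDE.ParabolicRieszPotentialProofs
import Literature.Analysis.FunctionSpaces.LpDualityTestFunctions
import HarnessLib

/-!
# Lemarié-Rieusset 2016, Lemma 13.5: the bootstrap step and the lemma, proved (duality route)

Analysis/FluidPDE proof file for the named fact
`Literature.Analysis.FluidPDE.LemarieRieusset2016.lemma13_5_step` (`CKNMorreyBootstrap.lean`;
Lemarié-Rieusset 2016, proof of Lemma 13.5, pp. 475–477: one step of the Morrey bootstrap,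
`1_{Q₂}u ∈ ℳ₂^{3,τ} ⟹ 1_{Q₃}u ∈ ℳ₂^{3,σ}`, `1/σ = 1/τ + 1/τ₂ - 1/5`) and hence for Lemma 13.5
itself (`LemarieRieusset2016.lemma13_5`, `CKNMorreyLemmas.lean`):

* `LemarieRieusset2016.lemma13_5_step_holds : lemma13_5_step`,
* `LemarieRieusset2016.lemma13_5_holds : lemma13_5` (through the accepted
  `lemma13_5_of_step`).

## The proof

The printed proof (pp. 475–477) represents `v = φu` through (13.50)–(13.52) and applies Adams'
inequality (Cor. 5.1) to each term. Here the representation is replaced by its **dual form**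
`LemarieRieusset2016.dual_pairing_bound` (`CKNMorreyDualEstimate.lean`): for every scalar test
function `θ` on `Q₃` and every unit vector `c`,
`|∫ θ ⟪u, c⟫| ≤ C₀ ∫|θ| + C ∫ (𝓘₂(1_{Q₂}|f|) + 𝓘₁(1_{Q₂}|u|²)) |θ|`, obtained by testing the
equations against the backward caloric fields (so that neither the Calderón commutator of
p. 476 nor a uniqueness theorem for the heat equation is needed). The two potentials are placed
in `ℳ₂^{3,σ}` exactly as the terms `𝓘₂(|φf|)` and `𝓘₁(1_{Q₂}|u|²)` of the printed bookkeeping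
(p. 477): `1_{Q₂}|f| ∈ ℳ₂^{10/7,ρ₀}`, `1_{Q₂}|u|² ∈ ℳ₂^{3/2,ρ₁}` (Hölder in Morrey spaces from
`1_{Q₂}u ∈ ℳ₂^{3,τ₂} ∩ ℳ₂^{3,τ}`), `1/ρ₀ = 1/σ + 2/5`, `1/ρ₁ = 1/σ + 1/5`, and Adams' inequality
`adams_parabolicRieszPotential` (**proved**, `ParabolicRieszPotentialProofs.lean`). Then, for a
cylinder `Q_r(z)`, the converse of Hölder's inequality on the open set `S = Q_r(z) ∩ Q₃`
(`FunctionSpaces.lintegral_rpow_enorm_le_of_forall_test`, `p = 3`) applied to each component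
`⟪u, eₖ⟫` turns the dual bound into `∫∫_S |⟪u, eₖ⟫|³ ≤ (C₀|S|^{1/3} + C ‖Ψ‖_{L³(S)})³`,
`Ψ = 𝓘₂(1_{Q₂}|f|) + 𝓘₁(1_{Q₂}|u|²)`, which is `O(r^{5(1-3/σ)})` (`|S| ≤ min(|Q_r|, |Q₃|)`,
`σ ≥ 3`), i.e. `1_{Q₃}u ∈ ℳ₂^{3,σ}`. The hypothesis `1_{Q₂}∇ ⊗ u ∈ ℳ₂^{2,τ₃}` of the step is not
needed in this route.

## References

* P. G. Lemarié-Rieusset, *The Navier–Stokes Problem in the 21st Century*, CRC Press (2016),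
  Lemma 13.5 p. 475 and its proof pp. 475–477; Cor. 5.1 p. 112. [LemarieRieusset2016]
-/

noncomputable section

open MeasureTheory Set Function Filter TopologicalSpace Metric
open scoped Topology RealInnerProductSpace ENNReal NNReal

namespace Literature.Analysis.FluidPDE

/-! ### Tools -/

/-- `L^r(Ω)` functions, `1 ≤ r`, are locally integrable on the open set `Ω ⊆ ℝ × ℝ³` (private copy
of the tool of `CKNPressureLocalizationProofs.lean`, to keep the imports light). [folklore] -/
private theorem locallyIntegrableOn_of_memLp_restrict_dual {F : Type*} [NormedAddCommGroup F]
    {g : ℝ × EuclideanSpace ℝ (Fin 3) → F} {Ω : Set (ℝ × EuclideanSpace ℝ (Fin 3))}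
    (hΩ : IsOpen Ω) {r : ℝ≥0∞} (hr : 1 ≤ r) (hg : MemLp g r (volume.restrict Ω)) :
    LocallyIntegrableOn g Ω volume := by
  rw [locallyIntegrableOn_iff hΩ.isLocallyClosed]
  intro K hKΩ hK
  have h1 : MemLp g r (volume.restrict K) := hg.mono_measure (Measure.restrict_mono hKΩ le_rfl)
  haveI : IsFiniteMeasure ((volume : Measure (ℝ × EuclideanSpace ℝ (Fin 3))).restrict K) :=
    ⟨by rw [Measure.restrict_apply_univ]; exact hK.measure_lt_top⟩
  exact memLp_one_iff_integrable.1 (h1.mono_exponent hr)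

/-- **`|u|³ ≤ 9 ∑ₖ |⟪u, eₖ⟫|³`** for the standard frame of `ℝ³` (`‖u‖ ≤ ∑ₖ |uₖ|` and the power
mean inequality), in `ℝ≥0∞` with real exponent `3`. [folklore] -/
theorem enorm_rpow_three_le_sum_inner (v : EuclideanSpace ℝ (Fin 3)) :
    ‖v‖ₑ ^ (3 : ℝ) ≤ 9 * ∑ k : Fin 3, ‖(⟪v, EuclideanSpace.basisFun (Fin 3) ℝ k⟫ : ℝ)‖ₑ ^ (3 : ℝ) := by
  set b := EuclideanSpace.basisFun (Fin 3) ℝ with hb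
  -- the real inequality
  have hnorm : ‖v‖ ≤ ∑ k, |⟪v, b k⟫| := by
    conv_lhs => rw [← b.sum_repr' v]
    refine (norm_sum_le _ _).trans (le_of_eq (Finset.sum_congr rfl fun k _ => ?_))
    rw [norm_smul, Real.norm_eq_abs, b.orthonormal.1 k, mul_one, real_inner_comm]
  have hpm : (∑ k, |⟪v, b k⟫|) ^ 3 ≤ 9 * ∑ k, |⟪v, b k⟫| ^ 3 := by
    have h := pow_sum_le_card_mul_sum_pow (s := Finset.univ) (f := fun k : Fin 3 => |⟪v, b k⟫|)
      (fun k _ => abs_nonneg _) 2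
    rw [Finset.card_univ, Fintype.card_fin] at h
    norm_num at h
    linarith [h]
  have hreal : ‖v‖ ^ 3 ≤ 9 * ∑ k, |⟪v, b k⟫| ^ 3 :=
    (pow_le_pow_left₀ (norm_nonneg _) hnorm 3).trans hpm
  -- transfer to `ℝ≥0∞`
  have h3 : ((3 : ℝ)) = ((3 : ℕ) : ℝ) := by norm_num
  rw [h3, ENNReal.rpow_natCast]
  simp_rw [ENNReal.rpow_natCast]
  rw [← ofReal_norm, ← ENNReal.ofReal_pow (norm_nonneg _)]
  have hrhs : (9 : ℝ≥0∞) * ∑ k, ‖(⟪v, b k⟫ : ℝ)‖ₑ ^ 3 = ENNReal.ofReal (9 * ∑ k, |⟪v, b k⟫| ^ 3) := by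
    rw [ENNReal.ofReal_mul (by norm_num), ENNReal.ofReal_ofNat,
      ENNReal.ofReal_sum_of_nonneg (fun k _ => by positivity)]
    congr 1
    refine Finset.sum_congr rfl fun k _ => ?_
    rw [Real.enorm_eq_ofReal_abs, ENNReal.ofReal_pow (abs_nonneg _)]
  rw [hrhs]
  exact ENNReal.ofReal_le_ofReal hreal

/-- The volume of `S ⊆ Q_r(z) ∩ Q_{r₃}(z₀)` is `O(r^β)` for every `0 ≤ β ≤ 5`:
`vol(S) ≤ (2 vol(B₁) + vol(Q_{r₃})) r^β` (`r ≤ 1`: `vol(Q_r) = 2 vol(B₁) r⁵ ≤ 2vol(B₁) r^β`;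
`r ≥ 1`: `vol(Q_{r₃}) ≤ vol(Q_{r₃}) r^β`). [folklore] -/
theorem volume_inter_cylinders_le_rpow {β : ℝ} (hβ0 : 0 ≤ β) (hβ5 : β ≤ 5) (r₃ : ℝ)
    (z₀ : ℝ × EuclideanSpace ℝ (Fin 3)) :
    ∃ V : ℝ≥0, ∀ (z : ℝ × EuclideanSpace ℝ (Fin 3)) (r : ℝ), 0 < r →
      volume (parabolicCylinderCentered r z ∩ parabolicCylinderCentered r₃ z₀) ≤
        V * ENNReal.ofReal (r ^ β) := by
  have hB : volume (ball (0 : EuclideanSpace ℝ (Fin 3)) 1) < ∞ := measure_ball_lt_top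
  have hQ₃ : volume (parabolicCylinderCentered r₃ z₀) < ∞ := volume_parabolicCylinderCentered_lt_top r₃ z₀
  refine ⟨(2 * volume (ball (0 : EuclideanSpace ℝ (Fin 3)) 1) + volume (parabolicCylinderCentered r₃ z₀)).toNNReal,
    fun z r hr => ?_⟩
  rw [ENNReal.coe_toNNReal (ENNReal.add_ne_top.2 ⟨(ENNReal.mul_lt_top (by simp) hB).ne, hQ₃.ne⟩)]
  rcases le_or_gt r 1 with hr1 | hr1
  · -- `r ≤ 1`
    calc volume (parabolicCylinderCentered r z ∩ parabolicCylinderCentered r₃ z₀)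
        ≤ volume (parabolicCylinderCentered r z) := measure_mono inter_subset_left
      _ = ENNReal.ofReal (2 * r ^ 5) * volume (ball (0 : EuclideanSpace ℝ (Fin 3)) 1) :=
          volume_parabolicCylinderCentered hr z
      _ ≤ ENNReal.ofReal (2 * r ^ β) * volume (ball (0 : EuclideanSpace ℝ (Fin 3)) 1) := by
          gcongr
          calc r ^ (5 : ℕ) = r ^ (5 : ℝ) := by rw [← Real.rpow_natCast]; norm_num
            _ ≤ r ^ β := Real.rpow_le_rpow_of_exponent_ge hr hr1 hβ5
      _ = 2 * volume (ball (0 : EuclideanSpace ℝ (Fin 3)) 1) * ENNReal.ofReal (r ^ β) := by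
          rw [ENNReal.ofReal_mul (by norm_num), ENNReal.ofReal_ofNat]; ring
      _ ≤ _ := by
          gcongr
          exact le_self_add
  · -- `r > 1`
    have h1 : (1 : ℝ≥0∞) ≤ ENNReal.ofReal (r ^ β) :=
      ENNReal.one_le_ofReal.2 (Real.one_le_rpow hr1.le hβ0)
    calc volume (parabolicCylinderCentered r z ∩ parabolicCylinderCentered r₃ z₀)
        ≤ volume (parabolicCylinderCentered r₃ z₀) := measure_mono inter_subset_right
      _ ≤ (2 * volume (ball (0 : EuclideanSpace ℝ (Fin 3)) 1) + volume (parabolicCylinderCentered r₃ z₀)) * 1 := by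
          rw [mul_one]; exact le_add_self
      _ ≤ _ := mul_le_mul' le_rfl h1

/-- `(x^{1/3})³ = x` in `ℝ≥0∞`. [folklore] -/
theorem rpow_third_pow_three (x : ℝ≥0∞) : (x ^ (1 / 3 : ℝ)) ^ 3 = x := by
  rw [← ENNReal.rpow_natCast, ← ENNReal.rpow_mul]
  norm_num

/-- **`(a x^{1/3} + b y^{1/3})³ ≤ 4 (a³ x + b³ y)`** in `ℝ≥0∞` (`(X + Y)³ ≤ 4(X³ + Y³)`).
[folklore] -/
theorem cube_add_le (a b x y : ℝ≥0∞) :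
    (a * x ^ (1 / 3 : ℝ) + b * y ^ (1 / 3 : ℝ)) ^ 3 ≤ 4 * (a ^ 3 * x + b ^ 3 * y) := by
  set X : ℝ≥0∞ := a * x ^ (1 / 3 : ℝ) with hX
  set Y : ℝ≥0∞ := b * y ^ (1 / 3 : ℝ) with hY
  have h := ENNReal.rpow_add_le_mul_rpow_add_rpow X Y (by norm_num : (1 : ℝ) ≤ 3)
  have h3 : ∀ z : ℝ≥0∞, z ^ (3 : ℝ) = z ^ 3 := fun z => by
    rw [show (3 : ℝ) = ((3 : ℕ) : ℝ) by norm_num, ENNReal.rpow_natCast]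
  rw [h3, h3, h3, show ((3 : ℝ) - 1) = 2 by norm_num, ENNReal.rpow_two] at h
  have hX3 : X ^ 3 = a ^ 3 * x := by rw [hX, mul_pow, rpow_third_pow_three]
  have hY3 : Y ^ 3 = b ^ 3 * y := by rw [hY, mul_pow, rpow_third_pow_three]
  rw [hX3, hY3] at h
  calc (X + Y) ^ 3 ≤ 2 ^ 2 * (a ^ 3 * x + b ^ 3 * y) := h
    _ = 4 * (a ^ 3 * x + b ^ 3 * y) := by norm_num

/-! ### The bootstrap step and Lemma 13.5 -/

namespace LemarieRieusset2016

set_option maxHeartbeats 800000 in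
/-- **The bootstrap step of Lemma 13.5, proved** (Lemarié-Rieusset 2016, proof of Lemma 13.5,
pp. 475–477): under the hypotheses of Lemma 13.5 on `Q₂ = Q_{r₂}(z₀) ⊆ Ω` and
`1_{Q₂}u ∈ ℳ₂^{3,τ}`, `τ > 5`, `1/τ > 1/5 - 1/τ₂`, one has `1_{Q₃}u ∈ ℳ₂^{3,σ}`,
`1/σ = 1/τ + 1/τ₂ - 1/5`, for every `Q₃ = Q_{r₃}(z₀)`, `0 < r₃ < r₂`. See the module docstring
for the (dual) route taken: `dual_pairing_bound`, Hölder in Morrey spaces, Adams' inequality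
(`adams_parabolicRieszPotential_holds`), and the converse of Hölder's inequality on the open
sets `Q_r(z) ∩ Q₃`. [cite: LemarieRieusset2016, proof of Lemma 13.5 pp. 475–477] -/
theorem lemma13_5_step_holds : lemma13_5_step := by
  intro ν q₀ τ₀ τ₂ τ Ω f u p G z₀ r₂ hν hq₀ hq₀' hτ₀ hτ₂ hτ hcond hr₂ hS hΩ hf hu _hG huτ r₃ hr₃ hr₃r₂
  classical
  have hA := adams_parabolicRieszPotential_holds
  -- the two cylinders
  set Q₂ : Set (ℝ × (EuclideanSpace ℝ (Fin 3))) := FluidPDE.parabolicCylinderCentered r₂ z₀ with hQ₂_def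
  have hQ₂m : MeasurableSet Q₂ := (FluidPDE.isOpen_parabolicCylinderCentered r₂ z₀).measurableSet
  set Q₃ : Set (ℝ × (EuclideanSpace ℝ (Fin 3))) := FluidPDE.parabolicCylinderCentered r₃ z₀ with hQ₃_def
  have hQ₃Q₂ : Q₃ ⊆ Q₂ := FluidPDE.parabolicCylinderCentered_mono hr₃.le hr₃r₂.le z₀
  -- the exponents `s = 1/σ`, `ρ₀`, `ρ₁`
  have hτ0 : 0 < τ := by linarith
  have hτ₂0 : 0 < τ₂ := by linarith
  have h1τ : 1 / τ < 1 / 5 := one_div_lt_one_div_of_lt (by norm_num) hτ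
  have h1τ₂ : 1 / τ₂ < 1 / 5 := one_div_lt_one_div_of_lt (by norm_num) hτ₂
  set s : ℝ := 1 / τ + 1 / τ₂ - 1 / 5 with hs_def
  have hs0 : 0 < s := by rw [hs_def]; linarith
  have hs5 : s < 1 / 5 := by rw [hs_def]; linarith
  set σ : ℝ := 1 / s with hσ_def
  have hσs : 1 / σ = s := by rw [hσ_def, one_div_one_div]
  set ρ₀ : ℝ := 1 / (s + 2 / 5) with hρ₀_def
  set ρ₁ : ℝ := 1 / (s + 1 / 5) with hρ₁_def
  have hρ₀inv : 1 / ρ₀ = s + 2 / 5 := by rw [hρ₀_def, one_div_one_div]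
  have hρ₁inv : 1 / ρ₁ = s + 1 / 5 := by rw [hρ₁_def, one_div_one_div]
  have hρ₀pos : 0 < ρ₀ := by positivity
  have hρ₁pos : 0 < ρ₁ := by positivity
  have hρ₀lo : 5 / 3 < ρ₀ := by
    rw [hρ₀_def, lt_one_div (by norm_num) (by positivity)]; linarith
  have hρ₀hi : ρ₀ < 5 / 2 := by
    rw [hρ₀_def, one_div_lt (by positivity) (by norm_num)]; linarith
  have hρ₁lo : 5 / 2 < ρ₁ := by
    rw [hρ₁_def, lt_one_div (by norm_num) (by positivity)]; linarith
  have hρ₁hi : ρ₁ < 5 := by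
    rw [hρ₁_def, one_div_lt (by positivity) (by norm_num)]; linarith
  have hρ₀s : ρ₀ * s < 1 / 3 := by
    rw [hρ₀_def, one_div_mul_eq_div, div_lt_iff₀ (by positivity)]; linarith
  have hρ₁s : ρ₁ * s < 1 / 2 := by
    rw [hρ₁_def, one_div_mul_eq_div, div_lt_iff₀ (by positivity)]; linarith
  have hl₀ : 1 - 2 * ρ₀ / 5 = ρ₀ * s := by
    have : ρ₀ * s + 2 * ρ₀ / 5 = 1 := by rw [hρ₀_def]; field_simp
    linarith
  have hl₁ : 1 - 1 * ρ₁ / 5 = ρ₁ * s := by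
    have : ρ₁ * s + ρ₁ / 5 = 1 := by rw [hρ₁_def]; field_simp
    linarith
  -- Adams' integrability exponents are at least `3`
  have hA₀ : ∀ {p' : ℝ}, 1 ≤ p' → 3 ≤ p' / (1 - 2 * ρ₀ / 5) := fun hp' => by
    rw [hl₀, le_div_iff₀ (by positivity)]; nlinarith
  have hA₁ : ∀ {p' : ℝ}, 3 / 2 ≤ p' → 3 ≤ p' / (1 - 1 * ρ₁ / 5) := fun hp' => by
    rw [hl₁, le_div_iff₀ (by positivity)]; nlinarith
  have hσ₀ : 1 / σ = 1 / ρ₀ - 2 / 5 := by rw [hσs, hρ₀inv]; ring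
  have hσ₁ : 1 / σ = 1 / ρ₁ - 1 / 5 := by rw [hσs, hρ₁inv]; ring
  have h2ρ₀ : 2 * ρ₀ < 5 := by linarith
  have h1ρ₁ : 1 * ρ₁ < 5 := by linarith
  -- measurability of the sizes on `Q₂`, and their extensions by zero
  have hum : AEMeasurable (fun w : ℝ × (EuclideanSpace ℝ (Fin 3)) => ‖u w.1 w.2‖ₑ) (volume.restrict Q₂) :=
    hS.aemeasurable_enorm_velocity hΩ
  have hfm : AEMeasurable (fun w : ℝ × (EuclideanSpace ℝ (Fin 3)) => ‖f w.1 w.2‖ₑ) (volume.restrict Q₂) :=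
    hS.aemeasurable_enorm_force hΩ
  set U : ℝ × (EuclideanSpace ℝ (Fin 3)) → ℝ≥0∞ := Q₂.indicator fun w => ‖u w.1 w.2‖ₑ with hU_def
  set Fz : ℝ × (EuclideanSpace ℝ (Fin 3)) → ℝ≥0∞ := Q₂.indicator fun w => ‖f w.1 w.2‖ₑ with hFz_def
  have hUm : AEMeasurable U volume := (aemeasurable_indicator_iff hQ₂m).2 hum
  have hFzm : AEMeasurable Fz volume := (aemeasurable_indicator_iff hQ₂m).2 hfm
  have hUeq : ∀ w ∈ Q₂, U w = ‖u w.1 w.2‖ₑ := fun w hw => indicator_of_mem hw _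
  have hFzeq : ∀ w ∈ Q₂, Fz w = ‖f w.1 w.2‖ₑ := fun w hw => indicator_of_mem hw _
  -- the Morrey hypotheses, for the extensions by zero
  have hU₂ : IsParabolicMorreyOn Q₂ U 3 τ₂ := hu.of_le hQ₂m (by norm_num) fun w hw => (hUeq w hw).le
  have hUτ : IsParabolicMorreyOn Q₂ U 3 τ := huτ.of_le hQ₂m (by norm_num) fun w hw => (hUeq w hw).le
  have hF₂ : IsParabolicMorreyOn Q₂ Fz (10 / 7) τ₀ :=
    hf.of_le hQ₂m (by norm_num) fun w hw => (hFzeq w hw).le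
  /- ### the two potentials in `ℳ₂^{3,σ}` (Terms 2 and 7 of the printed bookkeeping) -/
  have hT2a : IsParabolicMorreyOn Q₂ (fun w => ‖f w.1 w.2‖ₑ) (10 / 7) ρ₀ :=
    (hF₂.of_exponent_le Subset.rfl hr₂ (by norm_num) (by linarith) (by linarith) hρ₀pos).of_le
      hQ₂m (by norm_num) fun w hw => (hFzeq w hw).ge
  have hT2 : IsParabolicMorreyOn univ
      (parabolicRieszPotential 2 (Q₂.indicator fun w => ‖f w.1 w.2‖ₑ)) 3 σ :=
    hT2a.adams_indicator hA hQ₂m hfm (by norm_num) (by linarith) (by norm_num) h2ρ₀ (by norm_num)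
      (hA₀ (by norm_num)) hσ₀
  have hHT6 : (3 : ℝ).HolderTriple 3 (3 / 2) := ⟨by norm_num, by norm_num, by norm_num⟩
  have hexp6 : (3 / 2 : ℝ) / ρ₁ = 3 / 2 / τ₂ + 3 / 2 / τ := by
    rw [div_eq_mul_one_div _ ρ₁, hρ₁inv, hs_def]; ring
  have huu : IsParabolicMorreyOn Q₂ (fun w => ‖u w.1 w.2‖ₑ * ‖u w.1 w.2‖ₑ) (3 / 2) ρ₁ :=
    (hU₂.mul hUτ hUm hUm hHT6 hexp6).of_le hQ₂m (by norm_num) fun w hw => by rw [hUeq w hw]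
  have hT7 : IsParabolicMorreyOn univ
      (parabolicRieszPotential 1 (Q₂.indicator fun w => ‖u w.1 w.2‖ₑ * ‖u w.1 w.2‖ₑ)) 3 σ :=
    huu.adams_indicator hA hQ₂m (hum.mul hum) (by norm_num) (by linarith) (by norm_num) h1ρ₁
      (by norm_num) (hA₁ (by norm_num)) hσ₁
  -- the sum `Ψ = 𝓘₂(1_{Q₂}|f|) + 𝓘₁(1_{Q₂}|u|²)` and its Morrey constant
  have mΨ₂ : AEMeasurable (parabolicRieszPotential 2 (Q₂.indicator fun w => ‖f w.1 w.2‖ₑ)) volume :=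
    aemeasurable_parabolicRieszPotential 2 hFzm
  have mΨ₁ : AEMeasurable
      (parabolicRieszPotential 1 (Q₂.indicator fun w => ‖u w.1 w.2‖ₑ * ‖u w.1 w.2‖ₑ)) volume :=
    aemeasurable_parabolicRieszPotential 1 ((aemeasurable_indicator_iff hQ₂m).2 (hum.mul hum))
  set Ψ : ℝ × (EuclideanSpace ℝ (Fin 3)) → ℝ≥0∞ := fun w =>
    parabolicRieszPotential 2 (Q₂.indicator fun w => ‖f w.1 w.2‖ₑ) w +
      parabolicRieszPotential 1 (Q₂.indicator fun w => ‖u w.1 w.2‖ₑ * ‖u w.1 w.2‖ₑ) w with hΨ_def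
  have mΨ : AEMeasurable Ψ volume := mΨ₂.add mΨ₁
  obtain ⟨MΨ, hMΨ⟩ := hT2.add hT7 mΨ₂ (by norm_num)
  -- the exponent `β = 5(1 - 3/σ) ∈ [0, 5]`
  have hσpos : 0 < σ := by positivity
  have hσ5 : 5 < σ := by rw [hσ_def, lt_one_div (by norm_num) hs0]; exact hs5
  set β : ℝ := 5 * (1 - 3 / σ) with hβ_def
  have hβ0 : 0 ≤ β := by
    have : 3 / σ ≤ 1 := (div_le_one hσpos).2 (by linarith)
    rw [hβ_def]; linarith
  have hβ5 : β ≤ 5 := by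
    have : 0 ≤ 3 / σ := by positivity
    rw [hβ_def]; linarith
  obtain ⟨V, hV⟩ := volume_inter_cylinders_le_rpow hβ0 hβ5 r₃ z₀
  /- ### the dual pairing bounds for the standard frame -/
  have hfloc : LocallyIntegrableOn (uncurry f) (Ω : Set (ℝ × (EuclideanSpace ℝ (Fin 3)))) volume :=
    locallyIntegrableOn_of_memLp_restrict_dual Ω.isOpen (ENNReal.one_le_ofReal.2 (by norm_num))
      hS.force_memLp
  have hdivf : ∀ φ' : ℝ → (EuclideanSpace ℝ (Fin 3)) → ℝ, IsSpaceTimeTestOn Ω φ' →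
      ∫ z in (Ω : Set (ℝ × (EuclideanSpace ℝ (Fin 3)))), ⟪f z.1 z.2, gradient (φ' z.1) z.2⟫ = 0 :=
    fun φ' hφ' => setIntegral_inner_gradient_eq_zero_of_iterated hfloc hS.divFree_force hφ'
  set b : OrthonormalBasis (Fin 3) ℝ (EuclideanSpace ℝ (Fin 3)) := EuclideanSpace.basisFun (Fin 3) ℝ
    with hb_def
  have hb1 : ∀ k, ‖b k‖ ≤ 1 := fun k => (b.orthonormal.1 k).le
  have Hex : ∀ k : Fin 3, ∃ C₀ C : ℝ≥0, ∀ θ : ℝ → (EuclideanSpace ℝ (Fin 3)) → ℝ,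
      IsSpaceTimeTestOn (FluidPDE.parabolicCylinderCenteredOpens r₃ z₀) θ →
      ‖∫ z : ℝ × (EuclideanSpace ℝ (Fin 3)), θ z.1 z.2 * ⟪u z.1 z.2, b k⟫‖ₑ ≤
        (C₀ : ℝ≥0∞) * (∫⁻ z : ℝ × (EuclideanSpace ℝ (Fin 3)), ‖θ z.1 z.2‖ₑ) +
        (C : ℝ≥0∞) * ∫⁻ z : ℝ × (EuclideanSpace ℝ (Fin 3)), Ψ z * ‖θ z.1 z.2‖ₑ := fun k =>
    dual_pairing_bound hS.solution hν hfloc hdivf hΩ hr₃ hr₃r₂ (b k) (hb1 k)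
  choose C₀ C HC using Hex
  /- ### the Morrey bound -/
  refine ⟨9 * ∑ k : Fin 3, 4 * ((C₀ k) ^ 3 * V + (C k) ^ 3 * MΨ), fun z r hr => ?_⟩
  set S : Set (ℝ × (EuclideanSpace ℝ (Fin 3))) := FluidPDE.parabolicCylinderCentered r z ∩ Q₃ with hS_def
  have hSo : IsOpen S :=
    (FluidPDE.isOpen_parabolicCylinderCentered r z).inter (FluidPDE.isOpen_parabolicCylinderCentered r₃ z₀)
  have hSm : MeasurableSet S := hSo.measurableSet
  have hSQ₃ : S ⊆ Q₃ := inter_subset_right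
  -- `vol(S)`, `∫⁻_S Ψ³`
  have hvolS : volume S ≤ V * ENNReal.ofReal (r ^ β) := hV z r hr
  have hΨS : ∫⁻ w in S, Ψ w ^ (3 : ℝ) ≤ MΨ * ENNReal.ofReal (r ^ β) := by
    have h := hMΨ z r hr
    rw [inter_univ] at h
    exact (lintegral_mono_set inter_subset_left).trans h
  have hvolSfin : volume S < ∞ := hvolS.trans_lt (ENNReal.mul_lt_top ENNReal.coe_lt_top ENNReal.ofReal_lt_top)
  have hΨSfin : ∫⁻ w in S, Ψ w ^ (3 : ℝ) < ∞ :=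
    hΨS.trans_lt (ENNReal.mul_lt_top ENNReal.coe_lt_top ENNReal.ofReal_lt_top)
  -- integrability of `u` on `S` (through the compact closed box of radius `r₃`)
  set Kbox : Set (ℝ × (EuclideanSpace ℝ (Fin 3))) := Icc (z₀.1 - r₃ ^ 2) (z₀.1 + r₃ ^ 2) ×ˢ closedBall z₀.2 r₃
    with hKbox_def
  have hKc : IsCompact Kbox := isCompact_Icc.prod (isCompact_closedBall _ _)
  have hKΩ : Kbox ⊆ (Ω : Set (ℝ × (EuclideanSpace ℝ (Fin 3)))) := by
    refine Subset.trans (fun w hw => ?_) hΩ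
    obtain ⟨h1, h2⟩ := hw
    rw [mem_Icc] at h1
    rw [mem_closedBall] at h2
    have hsq : r₃ ^ 2 < r₂ ^ 2 := by nlinarith
    rw [FluidPDE.mem_parabolicCylinderCentered]
    exact ⟨⟨by linarith, by linarith⟩, lt_of_le_of_lt h2 hr₃r₂⟩
  have hSK : S ⊆ Kbox := hSQ₃.trans (parabolicCylinderCentered_subset_closedCylinder r₃ z₀)
  have iu : IntegrableOn (uncurry u) S volume :=
    (hS.solution.1.integrableOn_compact_subset hKΩ hKc).mono_set hSK
  -- the bound for one component
  have hcomp : ∀ k : Fin 3, ∫⁻ w in S, ‖(⟪u w.1 w.2, b k⟫ : ℝ)‖ₑ ^ (3 : ℝ) ≤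
      4 * (((C₀ k : ℝ≥0∞)) ^ 3 * (V * ENNReal.ofReal (r ^ β)) +
        ((C k : ℝ≥0∞)) ^ 3 * (MΨ * ENNReal.ofReal (r ^ β))) := by
    intro k
    -- the constant of the dual bound on `S`
    set A : ℝ≥0∞ := (C₀ k : ℝ≥0∞) * volume S ^ (1 / 3 : ℝ) +
      (C k : ℝ≥0∞) * (∫⁻ w in S, Ψ w ^ (3 : ℝ)) ^ (1 / 3 : ℝ) with hA_def
    have hAfin : A ≠ ∞ := by
      refine ENNReal.add_ne_top.2 ⟨ENNReal.mul_ne_top ENNReal.coe_ne_top ?_,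
        ENNReal.mul_ne_top ENNReal.coe_ne_top ?_⟩
      · exact ENNReal.rpow_ne_top_of_nonneg (by norm_num) hvolSfin.ne
      · exact ENNReal.rpow_ne_top_of_nonneg (by norm_num) hΨSfin.ne
    have hpq : (3 : ℝ).HolderConjugate (3 / 2) := ⟨by norm_num, by norm_num, by norm_num⟩
    -- the dual bound for one test function supported in `S`
    have hdual : ∀ Φ : ℝ × (EuclideanSpace ℝ (Fin 3)) → ℝ, ContDiff ℝ (⊤ : ℕ∞) Φ → HasCompactSupport Φ →
        tsupport Φ ⊆ S →
        |∫ w in S, ⟪u w.1 w.2, b k⟫ * Φ w| ≤ A.toReal * (eLpNorm Φ (ENNReal.ofReal (3 / 2)) volume).toReal := by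
      intro Φ hΦ1 hΦ2 hΦ3
      -- `Φ` as a space–time test function on `Q₃`
      set θ : ℝ → (EuclideanSpace ℝ (Fin 3)) → ℝ := fun t x => Φ (t, x) with hθ_def
      have huθ : uncurry θ = Φ := by funext w; rfl
      have hθ : IsSpaceTimeTestOn (FluidPDE.parabolicCylinderCenteredOpens r₃ z₀) θ := by
        refine ⟨?_, ?_, ?_⟩
        · rw [huθ]; exact hΦ1
        · rw [huθ]; exact hΦ2
        · rw [huθ]; exact hΦ3.trans hSQ₃
      have hΦ0 : ∀ w, w ∉ S → Φ w = 0 := fun w hw =>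
        image_eq_zero_of_notMem_tsupport fun h => hw (hΦ3 h)
      -- the pairing
      have hpair : ∫ w in S, ⟪u w.1 w.2, b k⟫ * Φ w =
          ∫ w : ℝ × (EuclideanSpace ℝ (Fin 3)), θ w.1 w.2 * ⟪u w.1 w.2, b k⟫ := by
        rw [setIntegral_eq_integral_of_forall_compl_eq_zero fun w hw => by rw [hΦ0 w hw, mul_zero]]
        exact integral_congr_ae (Eventually.of_forall fun w => mul_comm _ _)
      have hmain := HC k θ hθ
      -- Hölder for the two right-hand integrals
      set N : ℝ≥0∞ := eLpNorm Φ (ENNReal.ofReal (3 / 2)) volume with hN_def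
      have hN : N = (∫⁻ w, ‖Φ w‖ₑ ^ (3 / 2 : ℝ)) ^ (1 / (3 / 2 : ℝ)) := by
        rw [hN_def, eLpNorm_eq_lintegral_rpow_enorm_toReal (by simp) (by simp),
          ENNReal.toReal_ofReal (by norm_num)]
      have hNfin : N ≠ ∞ := (hΦ1.continuous.memLp_of_hasCompactSupport (μ := volume) hΦ2).eLpNorm_ne_top
      have hΦm : AEMeasurable (fun w => ‖Φ w‖ₑ) volume := hΦ1.continuous.measurable.enorm.aemeasurable
      have hθΦ : ∀ w : ℝ × (EuclideanSpace ℝ (Fin 3)), ‖θ w.1 w.2‖ₑ = ‖Φ w‖ₑ := fun w => rfl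
      have h1 : ∫⁻ w : ℝ × (EuclideanSpace ℝ (Fin 3)), ‖θ w.1 w.2‖ₑ ≤ volume S ^ (1 / 3 : ℝ) * N := by
        have hind : ∀ w : ℝ × (EuclideanSpace ℝ (Fin 3)), ‖θ w.1 w.2‖ₑ =
            S.indicator (fun _ => (1 : ℝ≥0∞)) w * ‖Φ w‖ₑ := by
          intro w
          rw [hθΦ]
          by_cases hw : w ∈ S
          · rw [indicator_of_mem hw, one_mul]
          · rw [indicator_of_notMem hw, zero_mul, hΦ0 w hw, enorm_zero]
        simp_rw [hind]
        have h := ENNReal.lintegral_mul_le_Lp_mul_Lq volume hpq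
          ((aemeasurable_indicator_iff (f := fun _ : ℝ × (EuclideanSpace ℝ (Fin 3)) => (1 : ℝ≥0∞)) hSm).2
            aemeasurable_const) hΦm
        refine h.trans (le_of_eq ?_)
        rw [hN]
        congr 1
        rw [show (fun w : ℝ × (EuclideanSpace ℝ (Fin 3)) =>
            S.indicator (fun _ => (1 : ℝ≥0∞)) w ^ (3 : ℝ)) = S.indicator (fun _ => (1 : ℝ≥0∞)) from
            funext fun w => by
              by_cases hw : w ∈ S
              · simp [indicator_of_mem hw]
              · simp [indicator_of_notMem hw],
          lintegral_indicator hSm, setLIntegral_one]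
      have h2 : ∫⁻ w : ℝ × (EuclideanSpace ℝ (Fin 3)), Ψ w * ‖θ w.1 w.2‖ₑ ≤
          (∫⁻ w in S, Ψ w ^ (3 : ℝ)) ^ (1 / 3 : ℝ) * N := by
        have hind : ∀ w : ℝ × (EuclideanSpace ℝ (Fin 3)), Ψ w * ‖θ w.1 w.2‖ₑ = S.indicator Ψ w * ‖Φ w‖ₑ := by
          intro w
          rw [hθΦ]
          by_cases hw : w ∈ S
          · rw [indicator_of_mem hw]
          · rw [indicator_of_notMem hw, zero_mul, hΦ0 w hw, enorm_zero, mul_zero]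
        simp_rw [hind]
        have h := ENNReal.lintegral_mul_le_Lp_mul_Lq volume hpq
          ((aemeasurable_indicator_iff hSm).2 mΨ.restrict) hΦm
        refine h.trans (le_of_eq ?_)
        rw [hN]
        congr 1
        rw [show (fun w : ℝ × (EuclideanSpace ℝ (Fin 3)) => S.indicator Ψ w ^ (3 : ℝ)) =
          S.indicator (fun w => Ψ w ^ (3 : ℝ)) from funext fun w => by
            by_cases hw : w ∈ S
            · simp [indicator_of_mem hw]
            · simp [indicator_of_notMem hw],
          lintegral_indicator hSm]
      -- hence `‖∫ θ u_k‖ₑ ≤ A N`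
      have hle : ‖∫ w : ℝ × (EuclideanSpace ℝ (Fin 3)), θ w.1 w.2 * ⟪u w.1 w.2, b k⟫‖ₑ ≤ A * N := by
        refine hmain.trans ?_
        calc (C₀ k : ℝ≥0∞) * (∫⁻ z : ℝ × (EuclideanSpace ℝ (Fin 3)), ‖θ z.1 z.2‖ₑ) +
              (C k : ℝ≥0∞) * ∫⁻ z : ℝ × (EuclideanSpace ℝ (Fin 3)), Ψ z * ‖θ z.1 z.2‖ₑ
            ≤ (C₀ k : ℝ≥0∞) * (volume S ^ (1 / 3 : ℝ) * N) +
              (C k : ℝ≥0∞) * ((∫⁻ w in S, Ψ w ^ (3 : ℝ)) ^ (1 / 3 : ℝ) * N) :=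
              add_le_add (mul_le_mul' le_rfl h1) (mul_le_mul' le_rfl h2)
          _ = A * N := by rw [hA_def]; ring
      rw [hpair, ← Real.norm_eq_abs, ← toReal_enorm]
      calc (‖∫ w : ℝ × (EuclideanSpace ℝ (Fin 3)), θ w.1 w.2 * ⟪u w.1 w.2, b k⟫‖ₑ).toReal
          ≤ (A * N).toReal := ENNReal.toReal_mono (ENNReal.mul_ne_top hAfin hNfin) hle
        _ = A.toReal * N.toReal := ENNReal.toReal_mul
    -- the converse of Hölder's inequality on `S`
    have hE : IntegrableOn (fun w : ℝ × (EuclideanSpace ℝ (Fin 3)) => ⟪u w.1 w.2, b k⟫) S volume :=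
      iu.inner_const (b k)
    haveI : (volume : Measure (ℝ × EuclideanSpace ℝ (Fin 3))).IsAddHaarMeasure := by
      rw [Measure.volume_eq_prod]; infer_instance
    have key := FunctionSpaces.lintegral_rpow_enorm_le_of_forall_test hSo hE hpq ENNReal.toReal_nonneg hdual
    refine key.trans ?_
    rw [show (3 : ℝ) = ((3 : ℕ) : ℝ) by norm_num, Real.rpow_natCast, ← ENNReal.toReal_pow,
      ENNReal.ofReal_toReal (ENNReal.pow_ne_top hAfin), hA_def]
    refine (cube_add_le _ _ _ _).trans ?_
    gcongr
  -- the full velocity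
  have mcomp : ∀ k : Fin 3, AEMeasurable
      (fun w : ℝ × (EuclideanSpace ℝ (Fin 3)) => ‖(⟪u w.1 w.2, b k⟫ : ℝ)‖ₑ ^ (3 : ℝ)) (volume.restrict S) :=
    fun k => ((iu.inner_const (b k)).aestronglyMeasurable.aemeasurable.enorm.pow_const _)
  calc ∫⁻ w in S, ‖u w.1 w.2‖ₑ ^ (3 : ℝ)
      ≤ ∫⁻ w in S, 9 * ∑ k : Fin 3, ‖(⟪u w.1 w.2, b k⟫ : ℝ)‖ₑ ^ (3 : ℝ) :=
        lintegral_mono fun w => enorm_rpow_three_le_sum_inner (u w.1 w.2)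
    _ = 9 * ∑ k : Fin 3, ∫⁻ w in S, ‖(⟪u w.1 w.2, b k⟫ : ℝ)‖ₑ ^ (3 : ℝ) := by
        rw [lintegral_const_mul' _ _ (by norm_num), lintegral_finsetSum' _ fun k _ => mcomp k]
    _ ≤ 9 * ∑ k : Fin 3, 4 * (((C₀ k : ℝ≥0∞)) ^ 3 * (V * ENNReal.ofReal (r ^ β)) +
          ((C k : ℝ≥0∞)) ^ 3 * (MΨ * ENNReal.ofReal (r ^ β))) := by
        gcongr with k
        exact hcomp k
    _ = ((9 * ∑ k : Fin 3, 4 * ((C₀ k) ^ 3 * V + (C k) ^ 3 * MΨ) : ℝ≥0) : ℝ≥0∞) *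
          ENNReal.ofReal (r ^ (5 * (1 - 3 / σ))) := by
        rw [← hβ_def]
        push_cast
        simp only [Finset.mul_sum, Finset.sum_mul]
        refine Finset.sum_congr rfl fun k _ => ?_
        ring

/-- **Lemma 13.5, proved** (Lemarié-Rieusset 2016, Lemma 13.5, p. 475: further Morrey estimates
on the velocity), from the proved step through the accepted iteration `lemma13_5_of_step`.
[cite: LemarieRieusset2016, Lemma 13.5 p. 475 and its proof pp. 475–477] -/
theorem lemma13_5_holds : lemma13_5 :=
  lemma13_5_of_step lemma13_5_step_holds

end LemarieRieusset2016

end Literature.Analysis.FluidPDE
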